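import Mathlib.Analysis.SpecialFunctions.Exp
import Mathlib.Analysis.SpecialFunctions.Pow.Real
import Mathlib.Analysis.Real.Pi.Bounds
import HarnessLib

/-!
# Negative side of K2Q `QuasiStaticSolenoidalCellTensorQ` (stmt-AnomalousDissipation-19072): the cone and gap parameters of the
# general-word floor — real arithmetic (helper, `--supports stmt-AnomalousDissipation-19072`)

Summits-side helper file (everything proved; no definitions, no named facts).  For `galerkin_floor_cell` at the replayed word
(`|ℓ| = 1`, `κ = ν/n²`, slot durations `≥ τm/ν`, `Λ = 2κ4π²(n/2)² = 2π²ν`, window `Q = qP/ν`):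
* `gap_param` — `exp(−(Λ/2)Q) ≤ 1/4` as soon as `qP ≥ 1`;
* `cone_params` — with the cone `η = 4Δ₁/(π²q(1−4ρ/3)τm)` and `q ≥ 32/(π²(1−4ρ/3)τm δ)`: the cone budget
  `4d ≤ q(1−4ρ/3)·(τm/ν)·Λ·η` holds whenever `d ≤ (1+δ/2)Δ₁` (`drain_const_le`), and `η ≤ (δ/8)Δ₁` (`rate_budget`).
This is NOT a proof of anomalous dissipation, and by itself not of `¬ K2Q`.
-/

set_option linter.dupNamespace false

noncomputable section

namespace Summit.AnomalousDissipation.AnomalousDissipation.Theorems.QuasiStaticSolenoidalCellTensorQ.Negative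

/-- **Rest gap over a window**: `exp(−(Λ/2)·Q) ≤ 1/4` for `Λ = 2(ν/n²)(4π²(n/2)²)`, `Q = q(P/ν)`, `qP ≥ 1`. -/
theorem gap_param {P ν n q : ℝ} (hν : 0 < ν) (hn : 0 < n) (hqP : 1 ≤ q * P) :
    Real.exp (-(2 * (ν / n ^ 2 * (4 * Real.pi ^ 2 * (n / 2) ^ 2)) / 2) * (q * (P / ν))) ≤ 1 / 4 := by
  have hπ := Real.pi_gt_three
  have e : -(2 * (ν / n ^ 2 * (4 * Real.pi ^ 2 * (n / 2) ^ 2)) / 2) * (q * (P / ν)) = -(Real.pi ^ 2 * (q * P)) := by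
    field_simp
    ring
  rw [e]
  have hx : 3 ≤ Real.pi ^ 2 * (q * P) := by nlinarith
  have h1 : Real.pi ^ 2 * (q * P) + 1 ≤ Real.exp (Real.pi ^ 2 * (q * P)) := Real.add_one_le_exp _
  rw [Real.exp_neg, inv_le_comm₀ (Real.exp_pos _) (by norm_num)]
  have : (1 / 4 : ℝ)⁻¹ = 4 := by norm_num
  rw [this]
  linarith

/-- **Cone parameters.** With `η = 4Δ₁/(π²q(1−4ρ/3)τm)`, `q ≥ 32/(π²(1−4ρ/3)τm δ)` and `d ≤ (1+δ/2)Δ₁` (`δ ≤ 1`):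
`0 ≤ η`, `η ≤ (δ/8)Δ₁`, and `4d ≤ q(1−4ρ/3)·(τm/ν)·(2(ν/n²)(4π²(n/2)²))·η`. -/
theorem cone_params {ρ τm ν δ d Δ₁ η n q : ℝ} (hρ : ρ < 3 / 4) (hτm : 0 < τm) (hν : 0 < ν) (hδ0 : 0 < δ) (hδ1 : δ ≤ 1)
    (hn : 0 < n) (hq0 : 0 < q) (hq : 32 / (Real.pi ^ 2 * (1 - 4 * ρ / 3) * τm * δ) ≤ q) (hΔ₁ : 0 ≤ Δ₁)
    (hd : d ≤ (1 + δ / 2) * Δ₁) (hη : η = 4 * Δ₁ / (Real.pi ^ 2 * q * (1 - 4 * ρ / 3) * τm)) :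
    0 ≤ η ∧ η ≤ δ / 8 * Δ₁ ∧
      4 * d ≤ q * (1 - 4 * ρ / 3) * (τm / ν) * (2 * (ν / n ^ 2 * (4 * Real.pi ^ 2 * (n / 2) ^ 2))) * η := by
  have hπ := Real.pi_gt_three
  have hρ' : 0 < 1 - 4 * ρ / 3 := by linarith
  have hD : 0 < Real.pi ^ 2 * q * (1 - 4 * ρ / 3) * τm := by positivity
  have hη0 : 0 ≤ η := by rw [hη]; positivity
  refine ⟨hη0, ?_, ?_⟩
  · -- `4/(π² q (1-4ρ/3) τm) ≤ δ/8` from the choice of `q`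
    rw [hη, div_le_iff₀ hD]
    have hq' : 32 ≤ q * (Real.pi ^ 2 * (1 - 4 * ρ / 3) * τm * δ) := by
      have := (div_le_iff₀ (by positivity : 0 < Real.pi ^ 2 * (1 - 4 * ρ / 3) * τm * δ)).1 hq
      linarith
    nlinarith
  · -- `q(1-4ρ/3)(τm/ν)·Λ·η = 8Δ₁ ≥ 4(1+δ/2)Δ₁ ≥ 4d`
    have e : q * (1 - 4 * ρ / 3) * (τm / ν) * (2 * (ν / n ^ 2 * (4 * Real.pi ^ 2 * (n / 2) ^ 2))) * η = 8 * Δ₁ := by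
      have h34 : 3 - ρ * 4 ≠ 0 := by nlinarith
      have h34' : 3 - 4 * ρ ≠ 0 := by nlinarith
      rw [hη]; field_simp; ring
    rw [e]
    nlinarith

end Summit.AnomalousDissipation.AnomalousDissipation.Theorems.QuasiStaticSolenoidalCellTensorQ.Negative

end
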